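import Mathlib
import Summits.NavierStokesRegularity.NavierStokesRegularity.Theorems.ThreadingFluxHorizonTowerFiniteTowerDefs
import Summits.NavierStokesRegularity.NavierStokesRegularity.Theorems.ThreadingFluxHorizonTowerFiniteTowerOppositeBelow
import HarnessLib

/-!
# Crux `PoloidalLiouville` (stmt-NavierStokesRegularity-1222), crux idea «horizon-threading-tower» (ns-idea-15):
# `FiniteTowerOppositeParityBelowHorizonTowerZonality` BY NAME (THM C″, opposite-parity top pair, companion of the second shell)

Support file (`--supports stmt-NavierStokesRegularity-1222`, helper; cell `ns-wall-extremal`, width hand ns-wall-eng-3 g5; 0 kit).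
The typed statement (`Theorems/ThreadingFluxHorizonTowerFiniteTowerDefs.lean`, append VIII) is closed by name from
`finiteTower_zonalForm_of_oppositeParityBelow` (`…FiniteTowerOppositeBelow`): the Defs-shaped binders (`D := K.max'`,
`D′ := (K.erase D).max'`, `b := (K.filter (· ≠ D′ ∧ · ≡ D′ mod 2)).max'`) are unfolded into the working binders.
HONEST LABEL: special cases of the crux-idea conjecture `HorizonTowerZonality` (finite towers, order one, a side condition on three
shells); general towers, `PoloidalLiouville` (1222) OPEN; W1 movement 0; NS regularity NOT proved.
-/

-- the summit and its single sub-problem share the name (CONVENTIONS §1)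
set_option linter.dupNamespace false

noncomputable section

namespace Summit.NavierStokesRegularity.NavierStokesRegularity.Theorems.PoloidalLiouville.HorizonTower

/-- ★★ `FiniteTowerOppositeParityBelowHorizonTowerZonality` BY NAME (THM C″). -/
theorem finiteTowerOppositeParityBelowHorizonTowerZonality : FiniteTowerOppositeParityBelowHorizonTowerZonality := by
  intro K H hK hK' hKb hK1 hH hhom hharm hpar hiso hD0 hD'0 hb0 hcop hL1
  set D := K.max' hK with hDdef
  set D' := (K.erase D).max' hK' with hD'def
  set S := (K.filter fun l => l ≠ D' ∧ l % 2 = D' % 2) with hSdef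
  set b := S.max' hKb with hbdef
  have hD : D ∈ K := Finset.max'_mem K hK
  have hmax : ∀ l ∈ K, l ≤ D := fun l hl => Finset.le_max' K l hl
  have hD'e : D' ∈ K.erase D := Finset.max'_mem _ hK'
  have hD' : D' ∈ K := Finset.mem_of_mem_erase hD'e
  have hlt : D' < D := lt_of_le_of_ne (hmax D' hD') (Finset.ne_of_mem_erase hD'e)
  have hsec : ∀ l ∈ K, l ≠ D → l ≤ D' := fun l hl hne => Finset.le_max' _ l (Finset.mem_erase.mpr ⟨hne, hl⟩)
  have hbS : b ∈ S := Finset.max'_mem S hKb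
  have hbK : b ∈ K := (Finset.mem_filter.mp hbS).1
  have hbD' : b ≠ D' := (Finset.mem_filter.mp hbS).2.1
  have hbpar : b % 2 = D' % 2 := (Finset.mem_filter.mp hbS).2.2
  have hbmax : ∀ l ∈ K, l ≠ D' → l % 2 = D' % 2 → l ≤ b := fun l hl hne hp =>
    Finset.le_max' S l (Finset.mem_filter.mpr ⟨hl, hne, hp⟩)
  exact finiteTower_zonalForm_of_oppositeParityBelow K H hK1 hH hhom hharm hL1 hD hD' hlt hmax hsec hpar hbK hbD' hbpar hbmax hiso
    hcop hD0 hD'0 hb0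

end Summit.NavierStokesRegularity.NavierStokesRegularity.Theorems.PoloidalLiouville.HorizonTower

end
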